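import Summits.RiemannHypothesis.RiemannHypothesis.Theorems.SemilocalDeletionSchurCells
import Summits.RiemannHypothesis.RiemannHypothesis.Theorems.SemilocalDeletionSchurFloor
import HarnessLib

/-!
# Schur cell certificates: SOUNDNESS (a `Valid` certificate is a Schur weight ⇒ the orbit-graph floor)

Sequel to `SemilocalDeletionSchurCells.lean` (the certificate structure `SchurCellCert`, its linear-time rational `check`, the
proposition `Valid`, the step weight `weight` and the cell-index bookkeeping).  Here:

* consistency of the CLAIMED index ranges: a translate `x ± log p` of a point of cell `i` that stays in the window lands in a
  cell of the claimed half-open range (`meetsPlus_cellIndex`, `mem_range_of_meetsPlus`, `weight_add_le`, …);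
* `schur_of_valid`: `Valid` and the enclosures `Llo ≤ log p ≤ Lhi`, `log p/√p ≤ whi` give the pointwise Schur inequality
  `Σ_p (log p/√p)·(φ(x − log p) + φ(x + log p)) ≤ rho·φ(x)` on the window for the step weight `φ = weight`;
* `re_weilSemilocalQuadratic_sdiff_ge_of_valid`, `semilocalGroundEnergy_sdiff_ge_of_valid`: the floor
  `Re Q_{S∖primes}(g) ≥ Re Q_S(g) − rho·‖g‖₂²` and `λ_min(S∖primes; c; P) ≥ λ_min(S; c; P) − rho`
  (`SemilocalDeletionSchurFloor.re_weilSemilocalQuadratic_sdiff_ge_of_schur` instantiated).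

Instances (one data file per cell, `decide +kernel` on `check`) import this file.  Nothing here bears on RH.
-/

set_option linter.dupNamespace false

noncomputable section

open Complex Filter Set MeasureTheory
open scoped Real Topology ComplexConjugate

namespace Summit.RiemannHypothesis.RiemannHypothesis.Theorems.SemilocalDeletionSchurCells

open Literature.NumberTheory.LFunctions
open Summit.RiemannHypothesis.RiemannHypothesis.Theorems.SemilocalDeletionCliff
open Summit.RiemannHypothesis.RiemannHypothesis.Theorems.SemilocalDeletionSchurFloor
open Summit.RiemannHypothesis.RiemannHypothesis.Theorems.HandoffSemilocalEnergy

namespace SchurCellCert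

variable {C : SchurCellCert}

/-! ### Consistency of the claimed ranges -/

/-- A translate `x + L` (`L ∈ [Llo, Lhi]`) of a point of cell `i` that stays in the window lands in a cell `j` with
`meetsPlus i j Llo Lhi`. -/
theorem meetsPlus_cellIndex (hV : C.Valid) {x L : ℝ} (hx : x ∈ Icc (-(C.c : ℝ)) C.c) (hy : x + L ∈ Icc (-(C.c : ℝ)) C.c)
    {Llo Lhi : ℚ} (hlo : (Llo : ℝ) ≤ L) (hhi : L ≤ Lhi) :
    C.meetsPlus (C.cellIndex x) (C.cellIndex (x + L)) Llo Lhi = true := by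
  obtain ⟨_, hil, hiu⟩ := cellIndex_spec hV hx
  obtain ⟨_, hjl, hju⟩ := cellIndex_spec hV hy
  unfold meetsPlus
  simp only [Bool.and_eq_true, decide_eq_true_eq]
  constructor
  · have : ((C.cellIndex (x + L) : ℚ) : ℝ) * C.h ≤ (((C.cellIndex x : ℚ) : ℝ) + 1) * C.h + Lhi := by push_cast; linarith
    exact_mod_cast this
  · have : ((C.cellIndex x : ℚ) : ℝ) * C.h + Llo ≤ (((C.cellIndex (x + L) : ℚ) : ℝ) + 1) * C.h := by push_cast; linarith
    exact_mod_cast this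

/-- The same for `x − L` and `meetsMinus`. -/
theorem meetsMinus_cellIndex (hV : C.Valid) {x L : ℝ} (hx : x ∈ Icc (-(C.c : ℝ)) C.c) (hy : x - L ∈ Icc (-(C.c : ℝ)) C.c)
    {Llo Lhi : ℚ} (hlo : (Llo : ℝ) ≤ L) (hhi : L ≤ Lhi) :
    C.meetsMinus (C.cellIndex x) (C.cellIndex (x - L)) Llo Lhi = true := by
  obtain ⟨_, hil, hiu⟩ := cellIndex_spec hV hx
  obtain ⟨_, hjl, hju⟩ := cellIndex_spec hV hy
  unfold meetsMinus
  simp only [Bool.and_eq_true, decide_eq_true_eq]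
  constructor
  · have : ((C.cellIndex (x - L) : ℚ) : ℝ) * C.h ≤ (((C.cellIndex x : ℚ) : ℝ) + 1) * C.h - Llo := by push_cast; linarith
    exact_mod_cast this
  · have : ((C.cellIndex x : ℚ) : ℝ) * C.h - Lhi ≤ (((C.cellIndex (x - L) : ℚ) : ℝ) + 1) * C.h := by push_cast; linarith
    exact_mod_cast this

/-- A consistent range claim contains every meeting cell (plus side). -/
theorem mem_range_of_meetsPlus (hV : C.Valid) {i j : ℕ} (hj : j < C.M) {a : ℕ × ℚ × ℚ × ℚ} {r : ℕ × ℕ × ℕ × ℕ}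
    (hr : C.rangeOK i a r = true) (hm : C.meetsPlus i j a.2.1 a.2.2.1 = true) : r.1 ≤ j ∧ j < r.2.1 := by
  have hh := h_pos_rat hV
  unfold rangeOK at hr
  unfold meetsPlus at hm
  simp only [Bool.and_eq_true, Bool.or_eq_true, Bool.not_eq_true', decide_eq_true_eq, decide_eq_false_iff_not] at hr hm
  obtain ⟨⟨⟨h1, h2⟩, -⟩, -⟩ := hr
  obtain ⟨hm1, hm2⟩ := hm
  constructor
  · by_contra hlt
    push Not at hlt
    rcases h1 with h0 | h1
    · omega
    · apply h1
      have hcast : ((r.1 - 1 : ℕ) : ℚ) = (r.1 : ℚ) - 1 := by rw [Nat.cast_sub (by omega)]; simp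
      have hjle : (j : ℚ) + 1 ≤ (r.1 : ℚ) := by exact_mod_cast (by omega : j + 1 ≤ r.1)
      rw [hcast]
      nlinarith
  · by_contra hlt
    push Not at hlt
    rcases h2 with hM | h2
    · omega
    · apply h2
      have hjge : (r.2.1 : ℚ) ≤ (j : ℚ) := by exact_mod_cast hlt
      nlinarith

/-- A consistent range claim contains every meeting cell (minus side). -/
theorem mem_range_of_meetsMinus (hV : C.Valid) {i j : ℕ} (hj : j < C.M) {a : ℕ × ℚ × ℚ × ℚ} {r : ℕ × ℕ × ℕ × ℕ}
    (hr : C.rangeOK i a r = true) (hm : C.meetsMinus i j a.2.1 a.2.2.1 = true) : r.2.2.1 ≤ j ∧ j < r.2.2.2 := by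
  have hh := h_pos_rat hV
  unfold rangeOK at hr
  unfold meetsMinus at hm
  simp only [Bool.and_eq_true, Bool.or_eq_true, Bool.not_eq_true', decide_eq_true_eq, decide_eq_false_iff_not] at hr hm
  obtain ⟨⟨-, h3⟩, h4⟩ := hr
  obtain ⟨hm1, hm2⟩ := hm
  constructor
  · by_contra hlt
    push Not at hlt
    rcases h3 with h0 | h3
    · omega
    · apply h3
      have hcast : ((r.2.2.1 - 1 : ℕ) : ℚ) = (r.2.2.1 : ℚ) - 1 := by rw [Nat.cast_sub (by omega)]; simp
      have hjle : (j : ℚ) + 1 ≤ (r.2.2.1 : ℚ) := by exact_mod_cast (by omega : j + 1 ≤ r.2.2.1)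
      rw [hcast]
      nlinarith
  · by_contra hlt
    push Not at hlt
    rcases h4 with hM | h4
    · omega
    · apply h4
      have hjge : (r.2.2.2 : ℚ) ≤ (j : ℚ) := by exact_mod_cast hlt
      nlinarith

/-- With a consistent claim, `φ(x + L) ≤ maxRange jloP jhiP` and `φ(x − L) ≤ maxRange jloM jhiM` for `x` in cell `i`. -/
theorem weight_add_le (hV : C.Valid) {x L : ℝ} (hx : x ∈ Icc (-(C.c : ℝ)) C.c) {a : ℕ × ℚ × ℚ × ℚ} {r : ℕ × ℕ × ℕ × ℕ}
    (hr : C.rangeOK (C.cellIndex x) a r = true) (hlo : ((a.2.1 : ℚ) : ℝ) ≤ L) (hhi : L ≤ ((a.2.2.1 : ℚ) : ℝ)) :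
    C.weight (x + L) ≤ C.maxRange r.1 r.2.1 := by
  by_cases hy : x + L ∈ Icc (-(C.c : ℝ)) C.c
  · rw [weight_of_mem hy]
    obtain ⟨h1, h2⟩ := mem_range_of_meetsPlus hV (cellIndex_spec hV hy).1 hr (meetsPlus_cellIndex hV hx hy hlo hhi)
    exact_mod_cast C.le_maxRange h1 h2
  · rw [weight_of_not_mem hy]; exact_mod_cast C.maxRange_nonneg _ _

/-- The same on the minus side: `φ(x − L) ≤ maxRange jloM jhiM`. -/
theorem weight_sub_le (hV : C.Valid) {x L : ℝ} (hx : x ∈ Icc (-(C.c : ℝ)) C.c) {a : ℕ × ℚ × ℚ × ℚ} {r : ℕ × ℕ × ℕ × ℕ}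
    (hr : C.rangeOK (C.cellIndex x) a r = true) (hlo : ((a.2.1 : ℚ) : ℝ) ≤ L) (hhi : L ≤ ((a.2.2.1 : ℚ) : ℝ)) :
    C.weight (x - L) ≤ C.maxRange r.2.2.1 r.2.2.2 := by
  by_cases hy : x - L ∈ Icc (-(C.c : ℝ)) C.c
  · rw [weight_of_mem hy]
    obtain ⟨h1, h2⟩ := mem_range_of_meetsMinus hV (cellIndex_spec hV hy).1 hr (meetsMinus_cellIndex hV hx hy hlo hhi)
    exact_mod_cast C.le_maxRange h1 h2
  · rw [weight_of_not_mem hy]; exact_mod_cast C.maxRange_nonneg _ _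

/-! ### The pointwise Schur inequality -/

/-- Paired list sums: if `f a ≤ g a b` along `zip l₁ l₂` (equal lengths) then `Σ f ≤ Σ g`. -/
theorem sum_map_le_sum_zipWith {α β : Type*} (f : α → ℝ) (g : α → β → ℝ) :
    ∀ (l₁ : List α) (l₂ : List β), l₂.length = l₁.length → (∀ ab ∈ List.zip l₁ l₂, f ab.1 ≤ g ab.1 ab.2) →
      (l₁.map f).sum ≤ (List.zipWith g l₁ l₂).sum
  | [], [], _, _ => by simp
  | [], _ :: _, h, _ => by simp at h
  | _ :: _, [], h, _ => by simp at h
  | a :: l₁, b :: l₂, hlen, hfg => by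
    simp only [List.map_cons, List.sum_cons, List.zipWith_cons_cons]
    refine add_le_add (hfg (a, b) (by simp)) (sum_map_le_sum_zipWith f g l₁ l₂ (by simpa using hlen) fun ab hab ↦ ?_)
    exact hfg ab (by simp [hab])

/-- **Soundness: the step weight is a Schur weight with constant `rho`.**  Hypotheses: `Valid` (e.g. from `check = true`),
distinct atom primes, and the enclosures `Llo ≤ log p ≤ Lhi`, `log p/√p ≤ whi` for every atom. -/
theorem schur_of_valid (hV : C.Valid) (hnodup : (C.atoms.map Prod.fst).Nodup)
    (henc : ∀ a ∈ C.atoms, ((a.2.1 : ℚ) : ℝ) ≤ Real.log a.1 ∧ Real.log a.1 ≤ ((a.2.2.1 : ℚ) : ℝ) ∧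
      Real.log a.1 / Real.sqrt a.1 ≤ ((a.2.2.2 : ℚ) : ℝ))
    (hprime : ∀ a ∈ C.atoms, a.1.Prime) {x : ℝ} (hx : x ∈ Icc (-(C.c : ℝ)) C.c) :
    ∑ p ∈ C.primes, Real.log p / Real.sqrt p * (C.weight (x - Real.log p) + C.weight (x + Real.log p)) ≤
      C.rho * C.weight x := by
  obtain ⟨hi, -, -⟩ := cellIndex_spec hV hx
  obtain ⟨hlen, hrange, hrow⟩ := rowOK_spec (hV.rows _ hi)
  -- rewrite the Finset sum as a list sum over the atoms
  unfold primes
  rw [List.sum_toFinset _ hnodup, List.map_map]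
  have hterm : ∀ ar ∈ List.zip C.atoms (C.rangesAt (C.cellIndex x)),
      ((fun p : ℕ ↦ Real.log p / Real.sqrt p * (C.weight (x - Real.log p) + C.weight (x + Real.log p))) ∘ Prod.fst) ar.1 ≤
        (fun a r ↦ ((C.atomTerm a r : ℚ) : ℝ)) ar.1 ar.2 := by
    intro ar har
    have ha : ar.1 ∈ C.atoms := (List.of_mem_zip har).1
    obtain ⟨hlo, hhi, hw⟩ := henc ar.1 ha
    have hw0 : 0 ≤ Real.log ar.1.1 / Real.sqrt ar.1.1 :=
      div_nonneg (Real.log_nonneg (by exact_mod_cast (hprime ar.1 ha).one_lt.le)) (Real.sqrt_nonneg _)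
    have hr := hrange ar har
    have h1 := weight_sub_le hV hx hr hlo hhi
    have h2 := weight_add_le hV hx hr hlo hhi
    have hs0 : 0 ≤ C.weight (x - Real.log ar.1.1) + C.weight (x + Real.log ar.1.1) :=
      add_nonneg (weight_nonneg hV _) (weight_nonneg hV _)
    simp only [Function.comp, atomTerm]
    push_cast
    calc Real.log ar.1.1 / Real.sqrt ar.1.1 * (C.weight (x - Real.log ar.1.1) + C.weight (x + Real.log ar.1.1))
        ≤ (ar.1.2.2.2 : ℝ) * (C.weight (x - Real.log ar.1.1) + C.weight (x + Real.log ar.1.1)) :=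
          mul_le_mul_of_nonneg_right hw hs0
      _ ≤ (ar.1.2.2.2 : ℝ) * ((C.maxRange ar.2.2.2.1 ar.2.2.2.2 : ℝ) + C.maxRange ar.2.1 ar.2.2.1) :=
          mul_le_mul_of_nonneg_left (by linarith) (by exact_mod_cast hV.atoms_nonneg ar.1 ha)
  have hsum := sum_map_le_sum_zipWith
    ((fun p : ℕ ↦ Real.log p / Real.sqrt p * (C.weight (x - Real.log p) + C.weight (x + Real.log p))) ∘ Prod.fst)
    (fun a r ↦ ((C.atomTerm a r : ℚ) : ℝ)) C.atoms (C.rangesAt (C.cellIndex x)) hlen hterm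
  have hcast : (List.zipWith (fun a r ↦ ((C.atomTerm a r : ℚ) : ℝ)) C.atoms (C.rangesAt (C.cellIndex x))).sum =
      ((C.rowLHS (C.cellIndex x) : ℚ) : ℝ) := by
    unfold rowLHS
    rw [Rat.cast_list_sum, ← List.map_uncurry_zip_eq_zipWith, ← List.map_uncurry_zip_eq_zipWith, List.map_map]
    rfl
  rw [hcast] at hsum
  rw [weight_of_mem hx]
  calc _ ≤ ((C.rowLHS (C.cellIndex x) : ℚ) : ℝ) := hsum
    _ ≤ ((C.rho * C.phiAt (C.cellIndex x) : ℚ) : ℝ) := by exact_mod_cast hrow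
    _ = (C.rho : ℝ) * (C.phiAt (C.cellIndex x) : ℝ) := by push_cast; ring

/-! ### The floor from a certificate -/

variable {g : ℝ → ℂ} {S : Finset ℕ} {P : (ℝ → ℂ) → Prop}

/-- **Schur floor from a cell certificate.** If the certificate is `Valid` (`check = true`), the atom primes are distinct members
of `S` with the stated enclosures and `c < log p`, then for every Weil test function on `[−c, c]`:
`Re Q_{S∖primes}(g) ≥ Re Q_S(g) − rho·‖g‖₂²`. -/
theorem re_weilSemilocalQuadratic_sdiff_ge_of_valid (hV : C.Valid) (hnodup : (C.atoms.map Prod.fst).Nodup)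
    (henc : ∀ a ∈ C.atoms, ((a.2.1 : ℚ) : ℝ) ≤ Real.log a.1 ∧ Real.log a.1 ≤ ((a.2.2.1 : ℚ) : ℝ) ∧
      Real.log a.1 / Real.sqrt a.1 ≤ ((a.2.2.2 : ℚ) : ℝ))
    (hprime : ∀ a ∈ C.atoms, a.1.Prime) (hS : C.primes ⊆ S) (hlog : ∀ p ∈ C.primes, (C.c : ℝ) < Real.log p)
    (hg : IsWeilTest g) (hsupp : tsupport g ⊆ Icc (-(C.c : ℝ)) C.c) :
    (weilSemilocalQuadratic S g).re - C.rho * ∫ x : ℝ, ‖g x‖ ^ 2 ≤ (weilSemilocalQuadratic (S \ C.primes) g).re := by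
  have hprime' : ∀ p ∈ C.primes, p.Prime := by
    intro p hp
    unfold primes at hp
    rw [List.mem_toFinset, List.mem_map] at hp
    obtain ⟨a, ha, rfl⟩ := hp
    exact hprime a ha
  exact re_weilSemilocalQuadratic_sdiff_ge_of_schur hg hsupp C.primes hS hprime' hlog
    (measurable_weight (C := C)) (weight_nonneg hV) (weight_le hV) (by exact_mod_cast hV.phiMin_pos)
    (fun x hx ↦ phiMin_le_weight hV hx) fun x hx ↦ schur_of_valid hV hnodup henc hprime hx

/-- Energy form: `λ_min(S∖primes; c; P) ≥ λ_min(S; c; P) − rho` for every constraint `P`. -/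
theorem semilocalGroundEnergy_sdiff_ge_of_valid (hV : C.Valid) (hnodup : (C.atoms.map Prod.fst).Nodup)
    (henc : ∀ a ∈ C.atoms, ((a.2.1 : ℚ) : ℝ) ≤ Real.log a.1 ∧ Real.log a.1 ≤ ((a.2.2.1 : ℚ) : ℝ) ∧
      Real.log a.1 / Real.sqrt a.1 ≤ ((a.2.2.2 : ℚ) : ℝ))
    (hprime : ∀ a ∈ C.atoms, a.1.Prime) (hS : C.primes ⊆ S) (hlog : ∀ p ∈ C.primes, (C.c : ℝ) < Real.log p) :
    semilocalGroundEnergy S P C.c - C.rho ≤ semilocalGroundEnergy (S \ C.primes) P C.c := by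
  have hprime' : ∀ p ∈ C.primes, p.Prime := by
    intro p hp
    unfold primes at hp
    rw [List.mem_toFinset, List.mem_map] at hp
    obtain ⟨a, ha, rfl⟩ := hp
    exact hprime a ha
  exact semilocalGroundEnergy_sdiff_ge_of_schur C.primes hS hprime' hlog (measurable_weight (C := C)) (weight_nonneg hV)
    (weight_le hV) (by exact_mod_cast hV.phiMin_pos) (fun x hx ↦ phiMin_le_weight hV hx)
    (by exact_mod_cast hV.rho_nonneg) fun x hx ↦ schur_of_valid hV hnodup henc hprime hx



/-- **Instance wrapper** (the shape used by the per-cell files): `Valid` (from `check`/chunks), one Boolean side check (distinct atom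
primes, `c < Llo` for every atom, every atom prime), the real enclosures, and the bookkeeping identities `primes = D`, `↑c = c′`,
`↑rho = ρ′` give `λ_min(S; c′; P) − ρ′ ≤ λ_min(S∖D; c′; P)` for every finite `S ⊇ D` and every constraint `P`. -/
theorem semilocalGroundEnergy_sdiff_ge_of_cert (hV : C.Valid)
    (hside : (decide (C.atoms.map Prod.fst).Nodup &&
      C.atoms.all fun a ↦ decide (C.c < a.2.1) && decide a.1.Prime) = true)
    (henc : ∀ a ∈ C.atoms, ((a.2.1 : ℚ) : ℝ) ≤ Real.log a.1 ∧ Real.log a.1 ≤ ((a.2.2.1 : ℚ) : ℝ) ∧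
      Real.log a.1 / Real.sqrt a.1 ≤ ((a.2.2.2 : ℚ) : ℝ))
    {D : Finset ℕ} (hD : C.primes = D) (hS : D ⊆ S) {c ρ : ℝ} (hc : ((C.c : ℚ) : ℝ) = c) (hρ : ((C.rho : ℚ) : ℝ) = ρ) :
    semilocalGroundEnergy S P c - ρ ≤ semilocalGroundEnergy (S \ D) P c := by
  simp only [Bool.and_eq_true, decide_eq_true_eq, List.all_eq_true] at hside
  obtain ⟨hnodup, hall⟩ := hside
  have hprime : ∀ a ∈ C.atoms, a.1.Prime := fun a ha ↦ (hall a ha).2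
  have hlog : ∀ p ∈ C.primes, (C.c : ℝ) < Real.log p := by
    intro p hp
    unfold primes at hp
    rw [List.mem_toFinset, List.mem_map] at hp
    obtain ⟨a, ha, rfl⟩ := hp
    have h1 : ((C.c : ℚ) : ℝ) < ((a.2.1 : ℚ) : ℝ) := by exact_mod_cast (hall a ha).1
    exact h1.trans_le (henc a ha).1
  have h := semilocalGroundEnergy_sdiff_ge_of_valid (P := P) hV hnodup henc hprime (hD ▸ hS) hlog
  rw [hD, hc, hρ] at h
  exact h

end SchurCellCert

end Summit.RiemannHypothesis.RiemannHypothesis.Theorems.SemilocalDeletionSchurCells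

end
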